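import Literature.MathematicalPhysics.QuantumLattice.SectorisedKernelNorm
import HarnessLib

/-!
# The sectorised `L¹–L^∞` norm is at most (anchored sector COUNT) × (fixed-tuple size)

Topic `MathematicalPhysics/QuantumLattice`; companion of `SectorisedKernelNorm` (the norm `‖W‖ = max_{p,s,x} Σ_{Ω ∈ A, Ω_p = s}
∫∏_{q ≠ p} dX_q |W_Ω(X)|` of Benfatto–Giuliani–Mastropietro 2006, (2.76)).  This is the bookkeeping step between the two halves of
a single-scale sectorised bound — the SIZE of each fixed sector tuple (Gram/tree bounds, (2.79)–(2.82)) and the NUMBER of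
admissible tuples through one anchored leg (the sector counting lemma, (2.83)/(2.96)) — stated once for an arbitrary label set,
constraint set `A` and weight `ε`:

* `sectorLegSum_le_sum_of_forall_le` — `legSum(p, s, x) ≤ Σ_{Ω ∈ A, Ω_p = s} B(Ω)` when every admissible tuple's pinned `L¹` size
  (leg `p` pinned at `x`) is `≤ B(Ω)`;
* `sectorLegSum_le_card_mul` — `legSum(p, s, x) ≤ #{Ω ∈ A : Ω_p = s} · B` for a uniform size `B ≥ 0`;
* **`sectorisedKernelNorm_le_card_mul`** — `‖W‖ ≤ N_c · B` when every anchored count `#{Ω ∈ A : Ω_p = s}` is `≤ N_c` and every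
  admissible fixed-tuple pinned size is `≤ B` (BGM 2006 (2.77): `J^{(1)} ≤` (number of sector choices through the anchored leg)
  × (the fixed-sector tree bound));
* `sectorisedKernelNorm_le_of_anchored_sums_le` — the weighted form `‖W‖ ≤ max_{p,s} Σ_{Ω ∈ A, Ω_p = s} B(Ω)` stated as: any `C`
  dominating all those anchored sums dominates the norm (for correlated / weighted counts).

Everything is proved; no definition, no named fact.

## Sources

G. Benfatto, A. Giuliani, V. Mastropietro, Ann. Henri Poincaré 7 (2006) 809–898, §2.8 (2.76)–(2.77), (2.83), (2.96)
[`BenfattoGiulianiMastropietro2006`].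
-/

noncomputable section

namespace Literature.MathematicalPhysics.QuantumLattice

open Finset

variable {𝕜 : Type*} [RCLike 𝕜] {S P : Type*} [DecidableEq S] [Fintype P] [DecidableEq P]

/-- **Leg sum ≤ sum of per-tuple sizes**: if for every admissible `Ω` the pinned `L¹` size of `W_Ω` with leg `p` pinned at `x` is
`≤ B Ω`, then `legSum(p,s,x) ≤ Σ_{Ω ∈ A, Ω_p = s} B Ω` (the sector sum of BGM (2.76) with the integrals bounded tuple by tuple).
[cite: BenfattoGiulianiMastropietro2006, §2.8 (2.76)] -/
theorem sectorLegSum_le_sum_of_forall_le (ε : ℝ) {m : ℕ} (A : Finset (Fin (m + 1) → S))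
    (W : (Fin (m + 1) → S) → (Fin (m + 1) → P) → 𝕜) (p : Fin (m + 1)) (s : S) (x : P) (B : (Fin (m + 1) → S) → ℝ)
    (hB : ∀ Ω ∈ A, ε ^ m * ∑ X ∈ univ.filter (fun X : Fin (m + 1) → P => X p = x), ‖W Ω X‖ ≤ B Ω) :
    sectorLegSum ε A W p s x ≤ ∑ Ω ∈ A.filter (fun Ω => Ω p = s), B Ω := by
  rw [sectorLegSum]
  exact sum_le_sum fun Ω hΩ => hB Ω (mem_filter.1 hΩ).1

/-- **Leg sum ≤ (anchored count) × (uniform size)** (BGM (2.77): the sector-choice count times the fixed-sector bound).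
[cite: BenfattoGiulianiMastropietro2006, §2.8 (2.76)-(2.77)] -/
theorem sectorLegSum_le_card_mul (ε : ℝ) {m : ℕ} (A : Finset (Fin (m + 1) → S))
    (W : (Fin (m + 1) → S) → (Fin (m + 1) → P) → 𝕜) (p : Fin (m + 1)) (s : S) (x : P) {B : ℝ}
    (hB : ∀ Ω ∈ A, ε ^ m * ∑ X ∈ univ.filter (fun X : Fin (m + 1) → P => X p = x), ‖W Ω X‖ ≤ B) :
    sectorLegSum ε A W p s x ≤ ((A.filter (fun Ω => Ω p = s)).card : ℝ) * B := by
  refine (sectorLegSum_le_sum_of_forall_le ε A W p s x (fun _ => B) hB).trans (le_of_eq ?_)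
  rw [sum_const, nsmul_eq_mul]

/-- **The sectorised norm is at most (anchored sector count) × (fixed-tuple size)** (BGM 2006 (2.77) with (2.83)/(2.96)): in degree
`m + 1`, if every anchored count `#{Ω ∈ A : Ω_p = s}` is `≤ N_c` and, for every admissible `Ω`, every leg `p` and position `x`, the
pinned `L¹` size `ε^m Σ_{X : X_p = x} ‖W_Ω(X)‖` is `≤ B` with `B ≥ 0`, then `‖W‖ ≤ N_c · B`.
[cite: BenfattoGiulianiMastropietro2006, §2.8 (2.76)-(2.77)] -/
theorem sectorisedKernelNorm_le_card_mul [Finite S] (ε : ℝ) {m : ℕ} (A : Finset (Fin (m + 1) → S))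
    (W : (Fin (m + 1) → S) → (Fin (m + 1) → P) → 𝕜) {Nc B : ℝ} (hNc : 0 ≤ Nc) (hB0 : 0 ≤ B)
    (hcard : ∀ (p : Fin (m + 1)) (s : S), (((A.filter (fun Ω => Ω p = s)).card : ℝ)) ≤ Nc)
    (hB : ∀ Ω ∈ A, ∀ (p : Fin (m + 1)) (x : P), ε ^ m * ∑ X ∈ univ.filter (fun X : Fin (m + 1) → P => X p = x), ‖W Ω X‖ ≤ B) :
    sectorisedKernelNorm ε (m + 1) A W ≤ Nc * B := by
  refine sectorisedKernelNorm_le_of_forall_le (mul_nonneg hNc hB0) fun p s x => ?_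
  refine (sectorLegSum_le_card_mul ε A W p s x fun Ω hΩ => hB Ω hΩ p x).trans ?_
  exact mul_le_mul_of_nonneg_right (hcard p s) hB0

/-- **Weighted / correlated form**: if `C ≥ 0` dominates every anchored sum of per-tuple sizes, `Σ_{Ω ∈ A, Ω_p = s} B(Ω) ≤ C`, and every
admissible tuple's pinned `L¹` size (any leg pinned anywhere) is `≤ B(Ω)`, then `‖W‖ ≤ C` — the form a correlated count (sizes that depend
on the tuple, e.g. smaller on the corner classes) plugs into (BGM (2.83): the sector sum weighted by the constraint functions).
[cite: BenfattoGiulianiMastropietro2006, §2.8 (2.76) and (2.83)] -/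
theorem sectorisedKernelNorm_le_of_anchored_sums_le [Finite S] (ε : ℝ) {m : ℕ} (A : Finset (Fin (m + 1) → S))
    (W : (Fin (m + 1) → S) → (Fin (m + 1) → P) → 𝕜) (B : (Fin (m + 1) → S) → ℝ) {C : ℝ} (hC : 0 ≤ C)
    (hsum : ∀ (p : Fin (m + 1)) (s : S), ∑ Ω ∈ A.filter (fun Ω => Ω p = s), B Ω ≤ C)
    (hB : ∀ Ω ∈ A, ∀ (p : Fin (m + 1)) (x : P), ε ^ m * ∑ X ∈ univ.filter (fun X : Fin (m + 1) → P => X p = x), ‖W Ω X‖ ≤ B Ω) :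
    sectorisedKernelNorm ε (m + 1) A W ≤ C :=
  sectorisedKernelNorm_le_of_forall_le hC fun p s x =>
    (sectorLegSum_le_sum_of_forall_le ε A W p s x B fun Ω hΩ => hB Ω hΩ p x).trans (hsum p s)

end Literature.MathematicalPhysics.QuantumLattice

end
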